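import Mathlib
import Summits.NavierStokesRegularity.NavierStokesRegularity.Theorems.DssFarFieldSlavingBlowupTypeIDssProfileSimilarityEnstrophyCutoffBudget
import Summits.NavierStokesRegularity.NavierStokesRegularity.Theorems.DssFarFieldSlavingBlowupTypeIDssProfileExplicitThreshold
import HarnessLib

/-!
# T31⁗: the time-only Type-I threshold `C < 1` WITHOUT any spatial hypothesis — every KNSS-gauge
  Type-I ancient mild field with `‖V(t,x)‖ ≤ C/√(−t)`, `C < 1`, vanishes (pub-ns-dss theory
  EXPLICIT-THRESHOLDS row T31⁗, DERIVED ×2 on paper, here a tree theorem; file 2/2; route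
  `DssFarFieldSlaving`, crux `BlowupTypeIDssProfile`, stmt-NavierStokesRegularity-0155 — SUPPORT;
  typer seat g17, 2026-08-26)

HONEST FRAMING. An exclusion statement about a HYPOTHETICAL object (a Type-I ancient mild solution in
the Koch–Nadirashvili–Seregin–Šverák gauge, `IsTypeIAncientMild C V`): IF `C < 1` THEN `V ≡ 0`.
Compared with the tree: T31″ (`typeI_ancient_eq_zero_of_typeI_lt_one`, Row 2) needs the space–time
decay hypothesis (D), Row 2′ (`typeI_ancient_eq_zero_of_timeConstant_lt_one`) needs the space–time
envelope `HasTypeIDecay`, and T31-G (`typeI_ancient_eq_zero_of_gaussianSmallTypeI`) is unconditional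
but only for `M < 0.3206…`; here the threshold `1` is reached with NO spatial hypothesis. It
discharges the hypothesis `h` of the conditional wrapper
`ExplicitThreshold.rdssClass_empty_of_timeOnlyThreshold` (whose CLASS conclusion was already known
from Row 2′, the class carrying `HasTypeIDecay` — recorded below as a kernel-checked `example`, not a
new theorem; the new content is the CLASSICAL statement) and it is the rate-class Liouville hypothesis
of `typeIRung_of_rateClassLiouville` (route TypeICertificateLadder) at every level `C < 1`. Nothing is
claimed about `C ≥ 1`; no threshold is claimed sharp; nothing numeric about any candidate; census
words on ACCEPT, if any, are the lead's; nothing here bears on Navier–Stokes regularity or blow-up.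

PROOF. File 1/2 (`…SimilarityEnstrophyCutoffBudget.lean`) gives, for the localised similarity
enstrophy `Z_R(s) = ∫ φ_R‖Ω(s)‖²` (`φ_R(y) = smoothTransition (2 − ‖y‖²/R²)`, the cut-off of crux
`MustSqueeze`), `Z_R' ≤ −κZ_R + (L/R)∫_{B̄_{2R}}‖Ω‖²`, `κ = ½(1 − C²) > 0`. A priori
`∫_{B̄_{2R}}‖Ω‖² ≤ Z_{2R}` (`φ_{2R} = 1` on `B̄_{2R}`) and `Z_ρ ≤ aρ³` uniformly in `s` (`‖Ω‖ ≤ K` by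
the class-uniform scale-invariant gauge bounds `typeIGauge_exists_pow_mul_norm_iteratedFDeriv_le`,
KNSS 2009 Prop. 4.1 + scaling). The solution being ANCIENT in `s`, the backward ODE bound
(`le_div_of_deriv_le_neg_mul_add`) turns `Z_ρ ≤ B(ρ)` into `Z_R ≤ (L/(κR))B(2R)`; four steps give
`Z_R ≲ R², R, 1, 1/R`; `Z_R` is monotone in `R`, so `Z_R ≤ a₄/R' → 0`: `Z ≡ 0`, `Ω ≡ 0`, and a
curl-free divergence-free bounded field is constant (`eq_of_curl_eq_zero_of_isDivFree_of_bounded`),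
killed by the Oseen gauge (`IsTypeIAncientMild.eq_zero_of_slice_const`).
-/

noncomputable section

set_option linter.dupNamespace false

namespace Summit.NavierStokesRegularity.NavierStokesRegularity.Theorems.SimilarityEnstrophy

open MeasureTheory Set Filter Topology Metric InnerProductSpace Function Real
open scoped RealInnerProductSpace Laplacian ContDiff
open Literature.Analysis Literature.Analysis.FluidPDE
open Summit.NavierStokesRegularity.NavierStokesRegularity.Theorems
open Summit.NavierStokesRegularity.NavierStokesRegularity.Theorems.GaussianGap
open Summit.NavierStokesRegularity.NavierStokesRegularity.Theorems.BlobRiccatiClosure.TypeIApexLiouville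

/-! ### A priori bounds on the cut-off enstrophy -/

section Apriori

variable {C : ℝ} {V : ℝ → EuclideanSpace ℝ (Fin 3) → EuclideanSpace ℝ (Fin 3)}

/-- `Z_R ≤ ∫_{B̄_{2R}} ‖Ω‖²` (`0 ≤ φ_R ≤ 1`, `φ_R = 0` off `B̄_{2R}`). [folklore] -/
theorem cutoffEnstrophy_le_setIntegral (hV : IsTypeIAncientMild C V) {R : ℝ} (hR : 0 < R) (s : ℝ) :
    (∫ y, smoothTransition (2 - ‖y‖ ^ 2 / R ^ 2) * ‖lerayVorticity V s y‖ ^ 2) ≤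
      ∫ y in closedBall (0 : EuclideanSpace ℝ (Fin 3)) (2 * R), ‖lerayVorticity V s y‖ ^ 2 := by
  have hcΩ : Continuous (lerayVorticity V s) :=
    (signedBudget_contDiff_lerayVorticity_slice hV s (n := 1)).continuous
  have hcφ : Continuous fun y : EuclideanSpace ℝ (Fin 3) => smoothTransition (2 - ‖y‖ ^ 2 / R ^ 2) :=
    (contDiff_smoothTransition_cutoff (n := 1) R).continuous
  have h0 : ∀ y ∉ closedBall (0 : EuclideanSpace ℝ (Fin 3)) (2 * R),
      smoothTransition (2 - ‖y‖ ^ 2 / R ^ 2) * ‖lerayVorticity V s y‖ ^ 2 = 0 := fun y hy => by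
    rw [smoothTransition_cutoff_eq_zero_of_notMem hR hy, zero_mul]
  rw [← setIntegral_eq_integral_of_forall_compl_eq_zero h0]
  refine setIntegral_mono_on ?_ ?_ measurableSet_closedBall fun y _ => ?_
  · exact ((hcφ.mul (hcΩ.norm.pow 2)).continuousOn).integrableOn_compact (isCompact_closedBall _ _)
  · exact ((hcΩ.norm.pow 2).continuousOn).integrableOn_compact (isCompact_closedBall _ _)
  · have h1 := smoothTransition_cutoff_le_one R y
    have h2 : 0 ≤ ‖lerayVorticity V s y‖ ^ 2 := sq_nonneg _
    nlinarith

/-- `∫_{B̄_{2R}} ‖Ω‖² ≤ Z_{2R}` (`φ_{2R} = 1` on `B̄_{2R}`, `φ_{2R} ≥ 0`). [folklore] -/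
theorem setIntegral_le_cutoffEnstrophy_two_mul (hV : IsTypeIAncientMild C V) {R : ℝ} (hR : 0 < R)
    (s : ℝ) :
    (∫ y in closedBall (0 : EuclideanSpace ℝ (Fin 3)) (2 * R), ‖lerayVorticity V s y‖ ^ 2) ≤
      ∫ y, smoothTransition (2 - ‖y‖ ^ 2 / (2 * R) ^ 2) * ‖lerayVorticity V s y‖ ^ 2 := by
  have hcΩ : Continuous (lerayVorticity V s) :=
    (signedBudget_contDiff_lerayVorticity_slice hV s (n := 1)).continuous
  have hcφ : Continuous fun y : EuclideanSpace ℝ (Fin 3) =>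
      smoothTransition (2 - ‖y‖ ^ 2 / (2 * R) ^ 2) :=
    (contDiff_smoothTransition_cutoff (n := 1) (2 * R)).continuous
  have h2R : 0 < 2 * R := by positivity
  have hint : Integrable fun y : EuclideanSpace ℝ (Fin 3) =>
      smoothTransition (2 - ‖y‖ ^ 2 / (2 * R) ^ 2) * ‖lerayVorticity V s y‖ ^ 2 :=
    (hcφ.mul (hcΩ.norm.pow 2)).integrable_of_hasCompactSupport
      ((hasCompactSupport_smoothTransition_cutoff h2R).mul_right)
  have heq : (∫ y in closedBall (0 : EuclideanSpace ℝ (Fin 3)) (2 * R), ‖lerayVorticity V s y‖ ^ 2) =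
      ∫ y in closedBall (0 : EuclideanSpace ℝ (Fin 3)) (2 * R),
        smoothTransition (2 - ‖y‖ ^ 2 / (2 * R) ^ 2) * ‖lerayVorticity V s y‖ ^ 2 := by
    refine setIntegral_congr_fun measurableSet_closedBall fun y hy => ?_
    rw [mem_closedBall, dist_zero_right] at hy
    rw [smoothTransition_cutoff_eq_one h2R hy, one_mul]
  rw [heq]
  exact setIntegral_le_integral hint (Eventually.of_forall fun y =>
    mul_nonneg (smoothTransition_cutoff_nonneg _ y) (sq_nonneg _))

/-- `∫_{B̄_{2R}} ‖Ω(s)‖² ≤ K² · (2R)³ · |B̄₁|` when `‖Ω‖ ≤ K` everywhere. [folklore] -/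
theorem setIntegral_closedBall_le_of_bound (hV : IsTypeIAncientMild C V) {K : ℝ}
    (hK : ∀ s y, ‖lerayVorticity V s y‖ ≤ K) {R : ℝ} (hR : 0 < R) (s : ℝ) :
    (∫ y in closedBall (0 : EuclideanSpace ℝ (Fin 3)) (2 * R), ‖lerayVorticity V s y‖ ^ 2) ≤
      K ^ 2 * ((2 * R) ^ 3 *
        (volume : Measure (EuclideanSpace ℝ (Fin 3))).real
          (closedBall (0 : EuclideanSpace ℝ (Fin 3)) 1)) := by
  have hcΩ : Continuous (lerayVorticity V s) :=
    (signedBudget_contDiff_lerayVorticity_slice hV s (n := 1)).continuous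
  have hK0 : 0 ≤ K := (norm_nonneg _).trans (hK s 0)
  have h1 : (∫ y in closedBall (0 : EuclideanSpace ℝ (Fin 3)) (2 * R), ‖lerayVorticity V s y‖ ^ 2) ≤
      ∫ y in closedBall (0 : EuclideanSpace ℝ (Fin 3)) (2 * R), K ^ 2 := by
    refine setIntegral_mono_on ?_ ?_ measurableSet_closedBall fun y _ => ?_
    · exact ((hcΩ.norm.pow 2).continuousOn).integrableOn_compact (isCompact_closedBall _ _)
    · exact (continuous_const.continuousOn).integrableOn_compact (isCompact_closedBall _ _)
    · exact pow_le_pow_left₀ (norm_nonneg _) (hK s y) 2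
  rw [setIntegral_const, smul_eq_mul,
    Measure.addHaar_real_closedBall' volume (0 : EuclideanSpace ℝ (Fin 3)) (by positivity : (0:ℝ) ≤ 2 * R),
    finrank_euclideanSpace_fin] at h1
  linarith

/-- **Monotonicity in the radius**: `Z_{R₀} ≤ Z_R` for `0 < R₀ ≤ R` (`φ_{R₀} ≤ φ_R` pointwise,
`smoothTransition` is monotone). [folklore] -/
theorem cutoffEnstrophy_mono (hV : IsTypeIAncientMild C V) {R₀ R : ℝ} (hR₀ : 0 < R₀) (hle : R₀ ≤ R)
    (s : ℝ) :
    (∫ y, smoothTransition (2 - ‖y‖ ^ 2 / R₀ ^ 2) * ‖lerayVorticity V s y‖ ^ 2) ≤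
      ∫ y, smoothTransition (2 - ‖y‖ ^ 2 / R ^ 2) * ‖lerayVorticity V s y‖ ^ 2 := by
  have hR : 0 < R := lt_of_lt_of_le hR₀ hle
  have hcΩ : Continuous (lerayVorticity V s) :=
    (signedBudget_contDiff_lerayVorticity_slice hV s (n := 1)).continuous
  have hint : ∀ {ρ : ℝ}, 0 < ρ → Integrable fun y : EuclideanSpace ℝ (Fin 3) =>
      smoothTransition (2 - ‖y‖ ^ 2 / ρ ^ 2) * ‖lerayVorticity V s y‖ ^ 2 := fun {ρ} hρ =>
    ((contDiff_smoothTransition_cutoff (n := 1) ρ).continuous.mul (hcΩ.norm.pow 2))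
      |>.integrable_of_hasCompactSupport ((hasCompactSupport_smoothTransition_cutoff hρ).mul_right)
  refine integral_mono (hint hR₀) (hint hR) fun y => ?_
  refine mul_le_mul_of_nonneg_right (Real.smoothTransition.monotone ?_) (sq_nonneg _)
  have h1 : ‖y‖ ^ 2 / R ^ 2 ≤ ‖y‖ ^ 2 / R₀ ^ 2 :=
    div_le_div_of_nonneg_left (sq_nonneg _) (by positivity) (pow_le_pow_left₀ hR₀.le hle 2)
  linarith

/-- `0 ≤ Z_R`. [folklore] -/
theorem cutoffEnstrophy_nonneg (V : ℝ → EuclideanSpace ℝ (Fin 3) → EuclideanSpace ℝ (Fin 3))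
    (R s : ℝ) :
    0 ≤ ∫ y, smoothTransition (2 - ‖y‖ ^ 2 / R ^ 2) * ‖lerayVorticity V s y‖ ^ 2 :=
  integral_nonneg fun y => mul_nonneg (smoothTransition_cutoff_nonneg R y) (sq_nonneg _)

end Apriori

/-! ### The bootstrap -/

section Bootstrap

variable {C : ℝ} {V : ℝ → EuclideanSpace ℝ (Fin 3) → EuclideanSpace ℝ (Fin 3)}

/-- **One bootstrap step.** If `Z_ρ(s) ≤ B(ρ)` for all `ρ ≥ 1` and all `s`, and the budget
`Z_R' ≤ −κZ_R + (L/R)∫_{B̄_{2R}}‖Ω‖²` holds with `κ > 0`, `L ≥ 0`, then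
`Z_R(s) ≤ (L/(κR))·B(2R)` for all `R ≥ 1`, `s` (the backward ODE bound, the solution being ancient
in `s`). [this file; folklore] -/
theorem cutoffEnstrophy_bootstrap_step (hV : IsTypeIAncientMild C V) {κ L : ℝ} (hκ : 0 < κ)
    (hL : 0 ≤ L)
    (hbudget : ∀ R : ℝ, 1 ≤ R → ∀ s : ℝ,
      deriv (fun σ => ∫ y, smoothTransition (2 - ‖y‖ ^ 2 / R ^ 2) * ‖lerayVorticity V σ y‖ ^ 2) s ≤
        -κ * (∫ y, smoothTransition (2 - ‖y‖ ^ 2 / R ^ 2) * ‖lerayVorticity V s y‖ ^ 2) +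
          L / R * ∫ y in closedBall (0 : EuclideanSpace ℝ (Fin 3)) (2 * R),
            ‖lerayVorticity V s y‖ ^ 2)
    {B : ℝ → ℝ}
    (hB : ∀ ρ : ℝ, 1 ≤ ρ → ∀ s : ℝ,
      (∫ y, smoothTransition (2 - ‖y‖ ^ 2 / ρ ^ 2) * ‖lerayVorticity V s y‖ ^ 2) ≤ B ρ) :
    ∀ R : ℝ, 1 ≤ R → ∀ s : ℝ,
      (∫ y, smoothTransition (2 - ‖y‖ ^ 2 / R ^ 2) * ‖lerayVorticity V s y‖ ^ 2) ≤
        L / (κ * R) * B (2 * R) := by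
  intro R hR1 s
  have hR : 0 < R := lt_of_lt_of_le one_pos hR1
  have h2R1 : 1 ≤ 2 * R := by linarith
  set Z : ℝ → ℝ := fun σ => ∫ y, smoothTransition (2 - ‖y‖ ^ 2 / R ^ 2) * ‖lerayVorticity V σ y‖ ^ 2
    with hZ
  have hd : Differentiable ℝ Z := fun σ =>
    (signedBudget_hasDerivAt_cutoffEnstrophy hV hR σ).differentiableAt
  have hbdd : ∃ B', ∀ σ, Z σ ≤ B' := ⟨B R, fun σ => hB R hR1 σ⟩
  have hZ' : ∀ σ, deriv Z σ ≤ -κ * Z σ + L / R * B (2 * R) := by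
    intro σ
    refine (hbudget R hR1 σ).trans ?_
    have hI := (setIntegral_le_cutoffEnstrophy_two_mul hV hR σ).trans (hB (2 * R) h2R1 σ)
    have hLR : 0 ≤ L / R := div_nonneg hL hR.le
    nlinarith
  have h := le_div_of_deriv_le_neg_mul_add hd hbdd hκ hZ' s
  calc Z s ≤ L / R * B (2 * R) / κ := h
    _ = L / (κ * R) * B (2 * R) := by field_simp

/-- **The cut-off enstrophy vanishes** for a KNSS-gauge Type-I field with constant `C < 1`:
`Z_R(s) = 0` for every `R ≥ 1` and every `s` (a priori `Z_ρ ≤ aρ³`; four bootstrap steps give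
`Z_R ≤ a₄/R`; `Z_R` is monotone in `R`, so `Z_R ≤ a₄/R' → 0`). [this file] -/
theorem cutoffEnstrophy_eq_zero_of_lt_one (hV : IsTypeIAncientMild C V) (hC1 : C < 1) :
    ∀ R : ℝ, 1 ≤ R → ∀ s : ℝ,
      (∫ y, smoothTransition (2 - ‖y‖ ^ 2 / R ^ 2) * ‖lerayVorticity V s y‖ ^ 2) = 0 := by
  have hC : 0 ≤ C := hV.nonneg
  -- the rate
  set κ : ℝ := (1 / 2) * (1 - C ^ 2) with hκdef
  have hC2 : C ^ 2 < 1 := by nlinarith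
  have hκ : 0 < κ := by rw [hκdef]; nlinarith
  -- the budget
  obtain ⟨L, hL, hbudget⟩ := deriv_cutoffEnstrophy_le hV
  have hbudget' : ∀ R : ℝ, 1 ≤ R → ∀ s : ℝ,
      deriv (fun σ => ∫ y, smoothTransition (2 - ‖y‖ ^ 2 / R ^ 2) * ‖lerayVorticity V σ y‖ ^ 2) s ≤
        -κ * (∫ y, smoothTransition (2 - ‖y‖ ^ 2 / R ^ 2) * ‖lerayVorticity V s y‖ ^ 2) +
          L / R * ∫ y in closedBall (0 : EuclideanSpace ℝ (Fin 3)) (2 * R),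
            ‖lerayVorticity V s y‖ ^ 2 := fun R hR s => by
    have := hbudget R hR s; rw [hκdef]; linarith
  -- the a priori cubic bound, uniformly in `s`
  obtain ⟨K₁, hK₁⟩ := typeIGauge_exists_pow_mul_norm_iteratedFDeriv_le C 1
  have hΩb : ∀ s y, ‖lerayVorticity V s y‖ ≤ ‖curlCLM‖ * K₁ := fun s y => by
    refine (norm_curl_le (lerayOrbit V s) y).trans
      (mul_le_mul_of_nonneg_left ?_ (norm_nonneg curlCLM))
    rw [← norm_iteratedFDeriv_one]
    exact norm_iteratedFDeriv_lerayOrbit_le hV hK₁ s y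
  set v₁ : ℝ := (volume : Measure (EuclideanSpace ℝ (Fin 3))).real
    (closedBall (0 : EuclideanSpace ℝ (Fin 3)) 1) with hv₁
  have hv₁0 : 0 ≤ v₁ := measureReal_nonneg
  set a : ℝ := (‖curlCLM‖ * K₁) ^ 2 * (8 * v₁) with ha
  have ha0 : 0 ≤ a := by positivity
  have hB0 : ∀ ρ : ℝ, 1 ≤ ρ → ∀ s : ℝ,
      (∫ y, smoothTransition (2 - ‖y‖ ^ 2 / ρ ^ 2) * ‖lerayVorticity V s y‖ ^ 2) ≤ a * ρ ^ 3 := by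
    intro ρ hρ1 s
    have hρ : 0 < ρ := lt_of_lt_of_le one_pos hρ1
    calc (∫ y, smoothTransition (2 - ‖y‖ ^ 2 / ρ ^ 2) * ‖lerayVorticity V s y‖ ^ 2)
        ≤ ∫ y in closedBall (0 : EuclideanSpace ℝ (Fin 3)) (2 * ρ), ‖lerayVorticity V s y‖ ^ 2 :=
          cutoffEnstrophy_le_setIntegral hV hρ s
      _ ≤ (‖curlCLM‖ * K₁) ^ 2 * ((2 * ρ) ^ 3 * v₁) := setIntegral_closedBall_le_of_bound hV hΩb hρ s
      _ = a * ρ ^ 3 := by rw [ha]; ring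
  -- four bootstrap steps
  set b : ℝ := L / κ with hb
  have hb0 : 0 ≤ b := div_nonneg hL hκ.le
  have hstep := fun (B : ℝ → ℝ) hB => cutoffEnstrophy_bootstrap_step hV hκ hL hbudget' (B := B) hB
  have hB1 : ∀ R : ℝ, 1 ≤ R → ∀ s : ℝ,
      (∫ y, smoothTransition (2 - ‖y‖ ^ 2 / R ^ 2) * ‖lerayVorticity V s y‖ ^ 2) ≤ 8 * a * b * R ^ 2 := by
    intro R hR1 s
    have hR : 0 < R := lt_of_lt_of_le one_pos hR1
    refine (hstep (fun ρ => a * ρ ^ 3) hB0 R hR1 s).trans (le_of_eq ?_)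
    rw [hb]; field_simp; ring
  have hB2 : ∀ R : ℝ, 1 ≤ R → ∀ s : ℝ,
      (∫ y, smoothTransition (2 - ‖y‖ ^ 2 / R ^ 2) * ‖lerayVorticity V s y‖ ^ 2) ≤
        32 * a * b ^ 2 * R := by
    intro R hR1 s
    have hR : 0 < R := lt_of_lt_of_le one_pos hR1
    refine (hstep (fun ρ => 8 * a * b * ρ ^ 2) hB1 R hR1 s).trans (le_of_eq ?_)
    rw [hb]; field_simp; ring
  have hB3 : ∀ R : ℝ, 1 ≤ R → ∀ s : ℝ,
      (∫ y, smoothTransition (2 - ‖y‖ ^ 2 / R ^ 2) * ‖lerayVorticity V s y‖ ^ 2) ≤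
        64 * a * b ^ 3 := by
    intro R hR1 s
    have hR : 0 < R := lt_of_lt_of_le one_pos hR1
    refine (hstep (fun ρ => 32 * a * b ^ 2 * ρ) hB2 R hR1 s).trans (le_of_eq ?_)
    rw [hb]; field_simp; ring
  have hB4 : ∀ R : ℝ, 1 ≤ R → ∀ s : ℝ,
      (∫ y, smoothTransition (2 - ‖y‖ ^ 2 / R ^ 2) * ‖lerayVorticity V s y‖ ^ 2) ≤
        64 * a * b ^ 4 / R := by
    intro R hR1 s
    have hR : 0 < R := lt_of_lt_of_le one_pos hR1
    refine (hstep (fun _ => 64 * a * b ^ 3) hB3 R hR1 s).trans (le_of_eq ?_)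
    rw [hb]; field_simp
  -- `R → ∞` through monotonicity in `R`
  intro R₀ hR₀1 s
  have hR₀ : 0 < R₀ := lt_of_lt_of_le one_pos hR₀1
  have hle : ∀ R : ℝ, R₀ ≤ R →
      (∫ y, smoothTransition (2 - ‖y‖ ^ 2 / R₀ ^ 2) * ‖lerayVorticity V s y‖ ^ 2) ≤
        64 * a * b ^ 4 / R := fun R hR =>
    (cutoffEnstrophy_mono hV hR₀ hR s).trans (hB4 R (hR₀1.trans hR) s)
  have hlim : Tendsto (fun R : ℝ => 64 * a * b ^ 4 / R) atTop (𝓝 0) :=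
    tendsto_const_nhds.div_atTop tendsto_id
  have hZle : (∫ y, smoothTransition (2 - ‖y‖ ^ 2 / R₀ ^ 2) * ‖lerayVorticity V s y‖ ^ 2) ≤ 0 :=
    ge_of_tendsto hlim (eventually_atTop.2 ⟨R₀, fun R hR => hle R hR⟩)
  exact le_antisymm hZle (cutoffEnstrophy_nonneg V R₀ s)

/-- **The similarity vorticity vanishes** for a KNSS-gauge Type-I field with constant `C < 1`
(`Z_R ≡ 0` with a continuous non-negative integrand and `φ_R = 1` on `B̄_R`). [this file] -/
theorem lerayVorticity_eq_zero_of_lt_one (hV : IsTypeIAncientMild C V) (hC1 : C < 1)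
    (s : ℝ) (y : EuclideanSpace ℝ (Fin 3)) : lerayVorticity V s y = 0 := by
  set R : ℝ := max 1 ‖y‖ with hRdef
  have hR1 : 1 ≤ R := le_max_left _ _
  have hR : 0 < R := lt_of_lt_of_le one_pos hR1
  have hZ := cutoffEnstrophy_eq_zero_of_lt_one hV hC1 R hR1 s
  have hcΩ : Continuous (lerayVorticity V s) :=
    (signedBudget_contDiff_lerayVorticity_slice hV s (n := 1)).continuous
  have hcφ : Continuous fun z : EuclideanSpace ℝ (Fin 3) => smoothTransition (2 - ‖z‖ ^ 2 / R ^ 2) :=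
    (contDiff_smoothTransition_cutoff (n := 1) R).continuous
  have hc : Continuous fun z : EuclideanSpace ℝ (Fin 3) =>
      smoothTransition (2 - ‖z‖ ^ 2 / R ^ 2) * ‖lerayVorticity V s z‖ ^ 2 := hcφ.mul (hcΩ.norm.pow 2)
  have hint : Integrable fun z : EuclideanSpace ℝ (Fin 3) =>
      smoothTransition (2 - ‖z‖ ^ 2 / R ^ 2) * ‖lerayVorticity V s z‖ ^ 2 :=
    hc.integrable_of_hasCompactSupport ((hasCompactSupport_smoothTransition_cutoff hR).mul_right)
  have hae : (fun z : EuclideanSpace ℝ (Fin 3) =>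
      smoothTransition (2 - ‖z‖ ^ 2 / R ^ 2) * ‖lerayVorticity V s z‖ ^ 2) =ᵐ[volume] 0 :=
    (integral_eq_zero_iff_of_nonneg (fun z => mul_nonneg (smoothTransition_cutoff_nonneg R z)
      (sq_nonneg _)) hint).1 hZ
  have hev : (fun z : EuclideanSpace ℝ (Fin 3) =>
      smoothTransition (2 - ‖z‖ ^ 2 / R ^ 2) * ‖lerayVorticity V s z‖ ^ 2) = fun _ => (0 : ℝ) :=
    (hc.ae_eq_iff_eq (μ := volume) continuous_const).1 hae
  have hy := congrFun hev y
  have hφy : smoothTransition (2 - ‖y‖ ^ 2 / R ^ 2) = 1 :=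
    smoothTransition_cutoff_eq_one hR (le_max_right _ _)
  rw [hφy, one_mul] at hy
  have : ‖lerayVorticity V s y‖ = 0 := pow_eq_zero_iff (n := 2) (by norm_num) |>.1 hy
  exact norm_eq_zero.1 this

end Bootstrap

/-! ### T31⁗ -/

/-- **T31⁗ (pub-ns-dss EXPLICIT-THRESHOLDS row T31⁗), CLASSICAL, NO spatial hypothesis.** A Type-I
ancient mild solution in the KNSS gauge (`IsTypeIAncientMild C V`: jointly smooth on `t < 0`,
divergence free, Oseen-mild between all pairs of negative times, `‖V(t,x)‖ ≤ C/√(−t)`) with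
`C < 1` vanishes identically on `t < 0`. Proof: the localised similarity enstrophy vanishes
(`cutoffEnstrophy_eq_zero_of_lt_one`), so `curl V(t) ≡ 0` for every `t < 0`, and a curl-free,
divergence-free, bounded field is constant (`eq_of_curl_eq_zero_of_isDivFree_of_bounded`), which
the Oseen gauge kills (`IsTypeIAncientMild.eq_zero_of_slice_const`). This is the hypothesis `h` of
`ExplicitThreshold.rdssClass_empty_of_timeOnlyThreshold` and the rate-class Liouville hypothesis of
`typeIRung_of_rateClassLiouville` at every level `C < 1`. Nothing is claimed for `C ≥ 1`.
[this file; theory EXPLICIT-THRESHOLDS row T31⁗ («M_t < 1 ⇒ u ≡ 0, no H3», DERIVED ×2 on paper,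
here a tree theorem); nothing here bears on NS regularity] -/
theorem typeI_ancient_eq_zero_of_rate_lt_one {C : ℝ}
    {V : ℝ → EuclideanSpace ℝ (Fin 3) → EuclideanSpace ℝ (Fin 3)} (hV : IsTypeIAncientMild C V)
    (hC1 : C < 1) : ∀ t < 0, ∀ x, V t x = 0 := by
  have hΩ0 : ∀ s y, lerayVorticity V s y = 0 := lerayVorticity_eq_zero_of_lt_one hV hC1
  have hcurl : ∀ t < 0, ∀ x, curl (V t) x = 0 := by
    intro t ht x
    set s : ℝ := -Real.log (-t) with hs
    have hts : -Real.exp (-s) = t := by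
      rw [hs, neg_neg, Real.exp_log (neg_pos.2 ht), neg_neg]
    have h := hΩ0 s ((Real.exp (-s / 2))⁻¹ • x)
    rw [lerayVorticity_apply, curl_lerayOrbit, smul_smul,
      mul_inv_cancel₀ (Real.exp_pos _).ne', one_smul, hts, smul_eq_zero] at h
    exact h.resolve_left (Real.exp_pos _).ne'
  have hconst : ∀ t < 0, ∀ x, V t x = V t 0 := fun t ht x =>
    eq_of_curl_eq_zero_of_isDivFree_of_bounded ((hV.contDiff_slice ht).of_le (by norm_cast))
      (hcurl t ht) (hV.isDivFree ht) (fun z => hV.norm_le ht z) x 0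
  exact fun t ht x => hV.eq_zero_of_slice_const (b := fun t => V t 0) hconst ht x

/-- **T31⁗ in the shape of the hypothesis `h` of `ExplicitThreshold.rdssClass_empty_of_timeOnlyThreshold`**
(`∀ C < 1, IsTypeIAncientMild C V → V ≡ 0`), verbatim. [this file] -/
theorem timeOnlyThreshold_hypothesis :
    ∀ ⦃C : ℝ⦄ ⦃V : ℝ → EuclideanSpace ℝ (Fin 3) → EuclideanSpace ℝ (Fin 3)⦄, C < 1 →
      IsTypeIAncientMild C V → ∀ t < 0, ∀ x, V t x = 0 :=
  fun _ _ hC hV => typeI_ancient_eq_zero_of_rate_lt_one hV hC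

/-- **T31⁗ for the TIME-ONLY CONSTANT at any class level, NO spatial hypothesis.** A KNSS-gauge
Type-I field `V` (`IsTypeIAncientMild C₀ V`, any `C₀`) whose time-only constant satisfies
`√(−t)‖V(t,x)‖ ≤ θ` for all `t < 0`, `x` with `θ < 1` vanishes on `t < 0` (the field is in the class
with constant `θ`). Compare Row 2′ `typeI_ancient_eq_zero_of_timeConstant_lt_one`, which needs the
space–time envelope `HasTypeIDecay C₀ V`. [this file; theory T31⁗; nothing here bears on NS regularity] -/
theorem typeI_ancient_eq_zero_of_timeConstant_lt_one_noDecay {C₀ θ : ℝ}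
    {V : ℝ → EuclideanSpace ℝ (Fin 3) → EuclideanSpace ℝ (Fin 3)} (hθ : θ < 1)
    (hV : IsTypeIAncientMild C₀ V) (hb : ∀ t < 0, ∀ x, Real.sqrt (-t) * ‖V t x‖ ≤ θ) :
    ∀ t < 0, ∀ x, V t x = 0 := by
  have hVθ : IsTypeIAncientMild θ V := by
    refine ⟨hV.1, hV.2.1, hV.2.2.1, fun t ht x => ?_⟩
    have hst : 0 < Real.sqrt (-t) := Real.sqrt_pos.2 (neg_pos.2 ht)
    rw [le_div_iff₀ hst, mul_comm]
    exact hb t ht x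
  exact typeI_ancient_eq_zero_of_rate_lt_one hVθ hθ

/-- **E3′ at CLASS level from T31⁗, with NO hypothesis `h`** (the conditional wrapper
`ExplicitThreshold.rdssClass_empty_of_timeOnlyThreshold` discharged): for every Type-I constant
`M < 1` the hypothesis class of `RdssProfileTruncation` (any factor `c > 1`, any twist `R ∈ O(3)`) is
EMPTY. (At class level this conclusion was already known unconditionally from Row 2′ through the
class's space–time envelope — `rdssClass_empty_of_timeConstant` —; the new content is the classical
theorem `typeI_ancient_eq_zero_of_rate_lt_one`, free of every spatial hypothesis.) DSS-BLIND. Census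
words on ACCEPT, if any, are the lead's. [this file; nothing numerical is asserted and nothing here
bears on NS regularity] -/
example {M : ℝ} (hM : M < 1) :
    ¬ ∃ (c : ℝ) (R : (EuclideanSpace ℝ (Fin 3)) ≃ₗᵢ[ℝ] (EuclideanSpace ℝ (Fin 3)))
        (u : ℝ → (EuclideanSpace ℝ (Fin 3)) → (EuclideanSpace ℝ (Fin 3))),
      1 < c ∧ IsAncientMildSolution 1 u ∧ (∀ t < 0, AEStronglyMeasurable (u t) volume) ∧
      IsRotatedDSS c R u ∧ HasTypeIDecay M u ∧ ¬ (∀ t < 0, u t =ᵐ[volume] 0) :=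
  ExplicitThreshold.rdssClass_empty_of_timeOnlyThreshold timeOnlyThreshold_hypothesis hM

end Summit.NavierStokesRegularity.NavierStokesRegularity.Theorems.SimilarityEnstrophy

end
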